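import Mathlib
import Summits.Ventures.HodgeRepro.PeriodCloserC7Chain
import Summits.Ventures.HodgeRepro.Tier3Weierstrass
import Summits.Ventures.HodgeRepro.Tier3ValueTransfer
import Summits.Ventures.HodgeRepro.Tier4.LitMuInvariant
import Summits.Ventures.HodgeRepro.Tier4.LitInterpolation
import Summits.Ventures.HodgeRepro.Tier4.LitMuInvariantApi
import Summits.Ventures.HodgeRepro.Tier4.Common.Automorphic
import Summits.Ventures.HodgeRepro.Tier4.Common.TargetBridge
import Summits.Ventures.HodgeRepro.Tier4.Common.ConcreteCocompact
import Summits.Ventures.HodgeRepro.Tier4.Line2.BranchCoefficients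
import Summits.Ventures.HodgeRepro.Tier4.Line2.HasEvalTorsionPt
import Summits.Ventures.HodgeRepro.Tier4.Line2.K1a
import Summits.Ventures.HodgeRepro.Tier4.Line2.K1b
import Summits.Ventures.HodgeRepro.Tier4.Line2.K1c
import Summits.Ventures.HodgeRepro.Tier4.TargetV3
import Summits.Ventures.HodgeRepro.Tier4.Common.TargetDataV3
import Summits.Ventures.HodgeRepro.Tier4.Common.AutomorphicFam
import Summits.Ventures.HodgeRepro.Tier4.Line2.N2Transfer

/-!
# Tier4/Line2/CloseFormPartI — LINE L2 close form, module 1 of 3: Part I, the endoscopic branch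

`EndoscopicInputs`, `P_of_R1_R2`, `exists_admissible_R1` — the skeleton's Part I (Skeleton.lean v0.16 L189–L237) verbatim,
in the namespace `….Tier4.Line2.CloseForm`.
(R-39, lead L8034: the close form goes through the GATE; the gate's `lint.statement-form` caps a Theorems file with
proofs at 400 lines, so the ONE close-form file of record — v0.2 = the v0.1 bytes ae651d9627e9699a544f292ac2dc99e89040019ebe76f89f4657c305158595b8 · 615
FILED S16093 with the two global instance attributes replaced by local `letI` — is split BY TOPIC into three modules whose
concatenation (imports / preamble / namespace lines aside) IS v0.2: `CloseFormPartI` (Part I), `CloseFormPartII` (Part II),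
`CloseForm` (Parts III–IV: the two `Input_…` defs and `target_L2v3_of_inputs`).  Nothing mathematical changes; the
skeleton Skeleton.lean v0.16 (149e57492cdfc1b9b085b226628060ec021bc4a90261752f8208ff5903fb9fe5 · 743) stays the line of
record, its display stays a declared sorry there.  HC_CM is NOT proved by anyone in this repository.)
-/

set_option autoImplicit false

noncomputable section

namespace Summit.Ventures.HodgeRepro.Tier4.Line2.CloseForm

open Summit.Ventures.HodgeRepro.PeriodCloser
open Summit.Ventures.HodgeRepro.Tier4.Common
open NumberField

/-! ## Part I — the endoscopic branch: (P) from one datum with (R1) ∧ (R2) (shared with Tier 3; NOT the novelty) -/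

variable {L : Type} [Field L] [NumberField L] [IsCMField L]

/-- **The standing inputs of the endoscopic branch** (night-2's names, each a displayed input with its locator in
PeriodCloserC7.lean): the identification (i) — doubling + seesaw, (P) ⟺ (P′) —, TP1 (Borade–… Thm 1.4), the
local discharge (E1)/(E2 of R1)/(E3)/(E5) on admissible data, the admissible family (base datum, self-duality,
N2-flips, one split prime, its anticyclotomic twists), Tate's product formula and the quadratic sign flip on
admissible data.  NO BHTY, NO `XiInfinite` (no cofiniteness is used on this line). -/
structure EndoscopicInputs (I : C7Face L) : Prop where
  /-- the identification (i): doubling form + seesaw form (P) ⟺ (P′) -/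
  ident : Identification I
  /-- TP1 = Borade et al. 2025 Thm 1.4 (toric periods of `Θ(β)` ⟺ (E1) ∧ (E2) ∧ central values) -/
  tp1 : Borade2025_Thm1_4 I
  /-- the local discharge: (E1), (E2) from (R1), (E3), (E5) on admissible data -/
  discharge : LocalDischarge I
  /-- the admissible family -/
  family : AdmissibleFamily I
  /-- Tate's product formula for the root numbers -/
  productFormula : ProductFormula I
  /-- the N2-compatible quadratic sign flip on admissible data -/
  flipAdm : FlipRootNumberAdm I

/-- **L2.0 — (P) from ONE admissible datum with (R1) ∧ (R2)** (PROVED): (E1), (E2), (E3), (E5) by the local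
discharge, (E4) = (R2), then `P'_of_endoscopic` (TP1) and the seesaw form of the identification, (P′) ⟹ (P). -/
theorem P_of_R1_R2 (I : C7Face L) (h : EndoscopicInputs I) (d : I.Datum) (hd : I.Admissible d)
    (hR1 : I.R1 d) (hR2 : I.R2 d) : I.P :=
  h.ident.seesaw.mpr (P'_of_endoscopic I h.tp1 d
    ⟨h.discharge.e1 d hd, h.discharge.e2_of_r1 d hd hR1, h.discharge.e3 d hd, hR2, h.discharge.e5 d hd⟩)

/-- **L2.1 — a sign-fixed admissible datum exists** (PROVED; the (S3) step of the landed chain, verbatim): the sign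
pattern of the base datum is even ((E3) + product formula), the N2-compatible flip makes it `(+1, +1, +1, +1)`. -/
theorem exists_admissible_R1 (I : C7Face L) (h : EndoscopicInputs I) :
    ∃ d : I.Datum, I.Admissible d ∧ I.R1 d := by
  obtain ⟨d₀, hd₀⟩ := h.family.base
  have heven := signPattern_even I h.productFormula d₀ (h.discharge.e3 d₀ hd₀)
  obtain ⟨J, hJ, hJ1⟩ := exists_flip_to_trivial (I.signPattern d₀) heven
  obtain ⟨d₁, hd₁, hchars₁⟩ := h.family.flip_mem d₀ J hd₀ hJ
  refine ⟨d₁, hd₁, fun j => ?_⟩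
  have hj := hJ1 j
  simp only [C7Face.signPattern] at hj
  rw [hchars₁]
  simp only [flipOn]
  by_cases hJj : J j = true
  · rw [if_pos hJj, h.flipAdm d₀ hd₀ j]
    rwa [if_pos hJj] at hj
  · rw [if_neg hJj]
    rwa [if_neg hJj] at hj

end Summit.Ventures.HodgeRepro.Tier4.Line2.CloseForm
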